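import Summits.ValiantsHypothesis.ValiantsHypothesis.Theorems.SymPencilSingSixClassificationAbsorb

/-!
# Route `SymPencil` — SING-SIX CLASSIFICATION, Theorem A (T6′): every `6`-dimensional linear
# subspace of `Sing Z(per₄)` lies in a cross, has two zero rows / columns, or is an exotic
# one-zero-line family `V_λ`, `V^gr` (ᵀ) — VERBATIM port, part 6/10 (`--supports`
# stmt-ValiantsHypothesis-5674 `SdcSuperquadratic`; rung currency only, nothing here bears on `VP ≠ VNP`)

PORT NOTE (val-width-5674-w2 g0′, helper mode; director-valiant R223 (a)): part 6/10 of a VERBATIM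
port of val-idea-18 g3/g4's SORRY-FREE Theorem A of `Cruxes/SdcSuperquadratic/Lines/
sing_six_classification.lean` rev 2.6 (sha256 dfb5f805c61d14b7…; here: `perpPlanes` … `pairPerm_of_T3_single`).
ALL mathematics and proofs are val-idea-18's (memo `SING-SIX-CLASSIFICATION.md`); the port changes
only the file split, the linear import chain, the namespace, and one-line docstrings on API lemmas.
NOT ported: the `sorry`-stubs of LIST leaves 3–5 and `sixDim_perDir_list` (leaves 3, 4 = landed
`SymPencilPerFourExoticNoSixSquares` / `SymPencilPerFourCrossFilter`; leaf 5 open).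
  Cut table: see part 1 (`…Defs`).
Honest label: Theorem A of a line, not the crux, not the LIST; `27 ≤ sdc(per₄) ≤ 29` unchanged; stmt-5674
open; `VP ≠ VNP` not moved; no summit statement is proved here. [folklore]
-/

noncomputable section
set_option linter.dupNamespace false
set_option linter.unusedVariables false
set_option linter.unusedSectionVars false

namespace Summit.ValiantsHypothesis.ValiantsHypothesis.Theorems.SymPencilSingSixClassification

open MvPolynomial Module Literature.Computability.AlgebraicComplexity
open Literature.Barriers.CriticalPhenomena.Haruspicy (fin4_cases)
variable {K : Type*} [Field K]

/-- **§3.3 PERPENDICULAR PLANES — PROVED** (rev 2.5; was `stub_perpPlanes`).  Pointwise every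
`d ∈ D` lies in `{row s = 0}`, `{row t = 0}` or some `E_{jc}` (`PermOrthPairs`); a vector space over
an infinite field is not a finite union of proper subspaces
(`Submodule.exists_forall_notMem_of_forall_ne_top`), so `D` lies in one piece.  Inside `E_{jc}` the
quadric is `q(d) = d_{sj} d_{tc} + d_{sc} d_{tj}`; polarising `q ≡ 0` on `D`: if the `s`-row
coordinates `(d_{sj}, d_{sc})` are injective on `D`, then `dim D = 2`, the preimages of `(1,0), (0,1)`
have `t`-rows `(e, 0), (0, -e)` and `D` is the GRAPH ruling `Γ_e` (`e = 0` would make `row t ≡ 0`);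
otherwise some `d₀ ≠ 0` in `D` has zero `s`-row, its `t`-row `(α, -β) ≠ 0` forces every `s`-row to be
parallel to `(α, β)` and (through one `d₁` with nonzero `s`-row) every `t`-row parallel to `(α, -β)`,
so `D ≤ range (prodGen …)` (dimension `≤ 2`), with equality by dimension: the PRODUCT ruling. -/
theorem perpPlanes [CharZero K] (hPOP : PermOrthPairs K) : PerpPlanes K := by
  intro D s t hst hsupp hD hperp
  by_cases hV : ∀ d ∈ D, row d s = 0
  · exact Or.inl hV
  by_cases hW : ∀ d ∈ D, row d t = 0
  · exact Or.inr (Or.inl hW)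
  push Not at hV hW
  obtain ⟨d₁, hd₁, hv₁⟩ := hV
  obtain ⟨d₂, hd₂, hw₂⟩ := hW
  -- STEP A: `D` lies in one piece `E_{jc}`
  obtain ⟨j, c, hjc, hE⟩ : ∃ j c : Fin 4, j ≠ c ∧
      ∀ d ∈ D, ∀ i, i ≠ j → i ≠ c → d (s, i) = 0 ∧ d (t, i) = 0 := by
    by_contra hnone
    have hcov : ∀ j c : Fin 4, ¬ ∀ d ∈ D, ∀ i, i ≠ j → i ≠ c → d (s, i) = 0 ∧ d (t, i) = 0 := by
      intro j c hall
      by_cases hjc : j = c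
      · obtain ⟨c', hc'⟩ := exists_ne j
        exact hnone ⟨j, c', hc'.symm, fun d hd i hij _ => hall d hd i hij (by rw [← hjc]; exact hij)⟩
      · exact hnone ⟨j, c, hjc, hall⟩
    have hne : ∀ o, perpPiece D s t o ≠ ⊤ := by
      intro o ho
      have hall : ∀ x : D, x ∈ perpPiece D s t o := fun x => by rw [ho]; exact Submodule.mem_top
      rcases o with _ | ⟨_ | ⟨j', c'⟩⟩
      · exact hv₁ (mem_perpPiece_none.mp (hall ⟨d₁, hd₁⟩))
      · exact hw₂ (mem_perpPiece_some_none.mp (hall ⟨d₂, hd₂⟩))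
      · exact hcov j' c' fun d hd => mem_perpPiece_some_some.mp (hall ⟨d, hd⟩)
    obtain ⟨x, hx⟩ := Submodule.exists_forall_notMem_of_forall_ne_top (perpPiece D s t) hne
    rcases hPOP (row (x : Fin 4 × Fin 4 → K) s) (row (x : Fin 4 × Fin 4 → K) t) (hperp x x.2) with
      h0 | h0 | ⟨j, c, _, hsup⟩
    · exact hx none (mem_perpPiece_none.mpr h0)
    · exact hx (some none) (mem_perpPiece_some_none.mpr h0)
    · exact hx (some (some (j, c))) (mem_perpPiece_some_some.mpr hsup)
  -- STEP B: inside `E_{jc}`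
  have hq : ∀ d ∈ D, d (s, j) * d (t, c) + d (s, c) * d (t, j) = 0 := fun d hd => hperp d hd j c hjc
  have hbil : ∀ d ∈ D, ∀ d' ∈ D, d (s, j) * d' (t, c) + d (s, c) * d' (t, j) +
      (d' (s, j) * d (t, c) + d' (s, c) * d (t, j)) = 0 := by
    intro d hd d' hd'
    have h := hq (d + d') (D.add_mem hd hd')
    simp only [Pi.add_apply] at h
    linear_combination h - hq d hd - hq d' hd'
  -- entrywise extensionality for arrays supported on rows `s, t` and columns `j, c`
  have ext4 : ∀ d d' : Fin 4 × Fin 4 → K,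
      (∀ i, i ≠ s → i ≠ t → row d i = 0) → (∀ i, i ≠ j → i ≠ c → d (s, i) = 0 ∧ d (t, i) = 0) →
      (∀ i, i ≠ s → i ≠ t → row d' i = 0) → (∀ i, i ≠ j → i ≠ c → d' (s, i) = 0 ∧ d' (t, i) = 0) →
      d (s, j) = d' (s, j) → d (s, c) = d' (s, c) → d (t, j) = d' (t, j) → d (t, c) = d' (t, c) →
      d = d' := by
    intro d d' hd hdE hd' hd'E e1 e2 e3 e4
    funext ik
    obtain ⟨i, k⟩ := ik
    by_cases his : i = s
    · rw [his]
      by_cases hkj : k = j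
      · rw [hkj]; exact e1
      by_cases hkc : k = c
      · rw [hkc]; exact e2
      rw [(hdE k hkj hkc).1, (hd'E k hkj hkc).1]
    by_cases hit : i = t
    · rw [hit]
      by_cases hkj : k = j
      · rw [hkj]; exact e3
      by_cases hkc : k = c
      · rw [hkc]; exact e4
      rw [(hdE k hkj hkc).2, (hd'E k hkj hkc).2]
    have h1 := congrFun (hd i his hit) k
    have h2 := congrFun (hd' i his hit) k
    simp only [row, Pi.zero_apply] at h1 h2
    rw [h1, h2]
  have hv₁' : d₁ (s, j) ≠ 0 ∨ d₁ (s, c) ≠ 0 := by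
    by_contra h0
    push Not at h0
    apply hv₁
    funext k
    show d₁ (s, k) = 0
    by_cases hkj : k = j
    · rw [hkj]; exact h0.1
    by_cases hkc : k = c
    · rw [hkc]; exact h0.2
    exact (hE d₁ hd₁ k hkj hkc).1
  have hw₂' : d₂ (t, j) ≠ 0 ∨ d₂ (t, c) ≠ 0 := by
    by_contra h0
    push Not at h0
    apply hw₂
    funext k
    show d₂ (t, k) = 0
    by_cases hkj : k = j
    · rw [hkj]; exact h0.1
    by_cases hkc : k = c
    · rw [hkc]; exact h0.2
    exact (hE d₂ hd₂ k hkj hkc).2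
  by_cases hinj : ∀ d ∈ D, d (s, j) = 0 → d (s, c) = 0 → d = 0
  · -- CASE (ii): the `s`-row coordinates are injective on `D`: GRAPH ruling
    obtain ⟨π, hπ_def⟩ : ∃ π : D →ₗ[K] K × K, π =
        ((LinearMap.proj (s, j) : (Fin 4 × Fin 4 → K) →ₗ[K] K).comp D.subtype).prod
          ((LinearMap.proj (s, c) : (Fin 4 × Fin 4 → K) →ₗ[K] K).comp D.subtype) := ⟨_, rfl⟩
    have hπ : ∀ x : D, π x = ((x : Fin 4 × Fin 4 → K) (s, j), (x : Fin 4 × Fin 4 → K) (s, c)) :=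
      fun x => by rw [hπ_def]; rfl
    have hπinj : Function.Injective π := by
      intro x y hxy
      rw [hπ, hπ, Prod.mk.injEq] at hxy
      apply Subtype.ext
      have := hinj ((x : Fin 4 × Fin 4 → K) - y) (D.sub_mem x.2 y.2)
        (by rw [Pi.sub_apply, hxy.1, sub_self]) (by rw [Pi.sub_apply, hxy.2, sub_self])
      exact sub_eq_zero.mp this
    have hle : finrank K D ≤ 2 := by
      have := LinearMap.finrank_le_finrank_of_injective hπinj
      simpa using this
    have hfin : finrank K D = 2 := le_antisymm hle hD
    have hπsurj : Function.Surjective π := by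
      refine (LinearMap.injective_iff_surjective_of_finrank_eq_finrank ?_).mp hπinj
      rw [hfin]; simp
    obtain ⟨gj, hgj⟩ := hπsurj (1, 0)
    obtain ⟨gc, hgc⟩ := hπsurj (0, 1)
    rw [hπ, Prod.mk.injEq] at hgj hgc
    obtain ⟨e, hge⟩ : ∃ e : K, (gj : Fin 4 × Fin 4 → K) (t, j) = e := ⟨_, rfl⟩
    have hq1 := hq gj gj.2
    rw [hgj.1, hgj.2] at hq1
    have hq2 := hq gc gc.2
    rw [hgc.1, hgc.2] at hq2
    have hb12 := hbil gj gj.2 gc gc.2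
    rw [hgj.1, hgj.2, hgc.1, hgc.2, hge] at hb12
    have hgjtc : (gj : Fin 4 × Fin 4 → K) (t, c) = 0 := by linear_combination hq1
    have hgctj : (gc : Fin 4 × Fin 4 → K) (t, j) = 0 := by linear_combination hq2
    have hgctc : (gc : Fin 4 × Fin 4 → K) (t, c) = -e := by linear_combination hb12
    have hrepr : ∀ d ∈ D,
        d = d (s, j) • (gj : Fin 4 × Fin 4 → K) + d (s, c) • (gc : Fin 4 × Fin 4 → K) := by
      intro d hd
      have hmem : d - (d (s, j) • (gj : Fin 4 × Fin 4 → K) + d (s, c) • (gc : Fin 4 × Fin 4 → K)) ∈ D :=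
        D.sub_mem hd (D.add_mem (D.smul_mem _ gj.2) (D.smul_mem _ gc.2))
      have := hinj _ hmem (by simp [hgj.1, hgc.1]) (by simp [hgj.2, hgc.2])
      exact sub_eq_zero.mp this
    by_cases he : e = 0
    · exfalso
      rcases hw₂' with h | h
      · apply h
        have := congrFun (hrepr d₂ hd₂) (t, j)
        simp only [Pi.add_apply, Pi.smul_apply, smul_eq_mul] at this
        rw [this, hge, hgctj, he]; ring
      · apply h
        have := congrFun (hrepr d₂ hd₂) (t, c)
        simp only [Pi.add_apply, Pi.smul_apply, smul_eq_mul] at this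
        rw [this, hgjtc, hgctc, he]; ring
    · refine Or.inr (Or.inr ⟨hfin, Or.inr ⟨j, c, e, hjc, he, fun d => ⟨fun hd => ?_, fun hc => ?_⟩⟩⟩)
      · refine ⟨hsupp d hd, hE d hd, ?_, ?_⟩
        · have := congrFun (hrepr d hd) (t, j)
          simp only [Pi.add_apply, Pi.smul_apply, smul_eq_mul] at this
          rw [this, hge, hgctj]; ring
        · have := congrFun (hrepr d hd) (t, c)
          simp only [Pi.add_apply, Pi.smul_apply, smul_eq_mul] at this
          rw [this, hgjtc, hgctc]; ring
      · obtain ⟨hds, hdE, htj, htc⟩ := hc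
        have : d = d (s, j) • (gj : Fin 4 × Fin 4 → K) + d (s, c) • (gc : Fin 4 × Fin 4 → K) := by
          apply ext4 d _ hds hdE
          · intro i his hit
            rw [row_add, row_smul, row_smul, hsupp _ gj.2 i his hit, hsupp _ gc.2 i his hit,
              smul_zero, smul_zero, add_zero]
          · intro i hij hic
            obtain ⟨a1, a2⟩ := hE _ gj.2 i hij hic
            obtain ⟨b1, b2⟩ := hE _ gc.2 i hij hic
            simp [a1, a2, b1, b2]
          · simp [hgj.1, hgc.1]
          · simp [hgj.2, hgc.2]
          · rw [Pi.add_apply, Pi.smul_apply, Pi.smul_apply, smul_eq_mul, smul_eq_mul, hge, hgctj, htj]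
            ring
          · rw [Pi.add_apply, Pi.smul_apply, Pi.smul_apply, smul_eq_mul, smul_eq_mul, hgjtc, hgctc,
              htc]
            ring
        rw [this]
        exact D.add_mem (D.smul_mem _ gj.2) (D.smul_mem _ gc.2)
  · -- CASE (i): some nonzero `d₀ ∈ D` has zero `s`-row: PRODUCT ruling
    push Not at hinj
    obtain ⟨d₀, hd₀, h0j, h0c, hd₀ne⟩ := hinj
    obtain ⟨α, hα⟩ : ∃ α : K, d₀ (t, j) = α := ⟨_, rfl⟩
    obtain ⟨β, hβ⟩ : ∃ β : K, d₀ (t, c) = -β := ⟨-d₀ (t, c), by rw [neg_neg]⟩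
    have hαβ : α ≠ 0 ∨ β ≠ 0 := by
      by_contra h0
      push Not at h0
      apply hd₀ne
      apply ext4 d₀ 0 (hsupp d₀ hd₀) (hE d₀ hd₀) (fun _ _ _ => rfl) (fun _ _ _ => ⟨rfl, rfl⟩)
      · rw [Pi.zero_apply]; exact h0j
      · rw [Pi.zero_apply]; exact h0c
      · rw [Pi.zero_apply, hα, h0.1]
      · rw [Pi.zero_apply, hβ, h0.2, neg_zero]
    have hpar_s : ∀ d ∈ D, d (s, j) * β = d (s, c) * α := by
      intro d hd
      have h := hbil d hd d₀ hd₀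
      rw [h0j, h0c, hα, hβ] at h
      linear_combination (-1 : K) * h
    obtain ⟨μ₁, hμ1j, hμ1c⟩ := exists_smul_of_par hαβ (hpar_s d₁ hd₁)
    have hμ₁ : μ₁ ≠ 0 := by
      rintro rfl
      rcases hv₁' with h | h
      · exact h (by rw [hμ1j, zero_mul])
      · exact h (by rw [hμ1c, zero_mul])
    have hX1 : α * d₁ (t, c) + β * d₁ (t, j) = 0 := by
      have h := hq d₁ hd₁
      rw [hμ1j, hμ1c] at h
      have : μ₁ * (α * d₁ (t, c) + β * d₁ (t, j)) = 0 := by linear_combination h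
      exact (mul_eq_zero.mp this).resolve_left hμ₁
    have hX : ∀ d ∈ D, α * d (t, c) + β * d (t, j) = 0 := by
      intro d hd
      obtain ⟨μ, hμj, hμc⟩ := exists_smul_of_par hαβ (hpar_s d hd)
      have h := hbil d₁ hd₁ d hd
      rw [hμ1j, hμ1c, hμj, hμc] at h
      have : μ₁ * (α * d (t, c) + β * d (t, j)) = 0 := by linear_combination h - μ * hX1
      exact (mul_eq_zero.mp this).resolve_left hμ₁
    have hαβ' : α ≠ 0 ∨ -β ≠ 0 := hαβ.imp id neg_ne_zero.mpr
    -- every `d ∈ D` is `μ • P₁ + ν • P₂`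
    have hDle : D ≤ LinearMap.range (prodGen s t j c α β) := by
      intro d hd
      obtain ⟨μ, hμj, hμc⟩ := exists_smul_of_par hαβ (hpar_s d hd)
      obtain ⟨ν, hνj, hνc⟩ := exists_smul_of_par hαβ' (x₁ := d (t, j)) (x₂ := d (t, c))
        (by linear_combination (-1 : K) * hX d hd)
      refine ⟨(μ, ν), ?_⟩
      rw [prodGen_apply]
      symm
      apply ext4 d _ (hsupp d hd) (hE d hd)
      · intro i his hit
        rw [row_add, row_smul, row_smul, row_rowAt_ne his, row_rowAt_ne hit, smul_zero, smul_zero,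
          add_zero]
      · intro i hij hic
        simp [rowAt_apply_ne hst, rowAt_apply_ne hst.symm, lvec_apply_of_ne hij hic]
      · simp [rowAt_apply_ne hst, lvec_apply_left hjc, hμj]
      · simp [rowAt_apply_ne hst, lvec_apply_right hjc, hμc]
      · simp [rowAt_apply_ne hst.symm, lvec_apply_left hjc, hνj]
      · simp [rowAt_apply_ne hst.symm, lvec_apply_right hjc, hνc]
    have hrange_le : finrank K (LinearMap.range (prodGen s t j c α β)) ≤ 2 := by
      have := LinearMap.finrank_range_le (prodGen s t j c α β)
      simpa using this
    have hfin : finrank K D = 2 := le_antisymm ((Submodule.finrank_mono hDle).trans hrange_le) hD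
    have hDeq : D = LinearMap.range (prodGen s t j c α β) :=
      Submodule.eq_of_le_of_finrank_le hDle (by rw [hfin]; exact hrange_le)
    refine Or.inr (Or.inr ⟨hfin, Or.inl ⟨j, c, α, β, hjc, hαβ, fun d => ?_⟩⟩)
    rw [hDeq, LinearMap.mem_range]
    constructor
    · rintro ⟨μν, rfl⟩
      rw [prodGen_apply]
      refine ⟨?_, ⟨μν.1, ?_⟩, ⟨μν.2, ?_⟩⟩
      · intro i his hit
        rw [row_add, row_smul, row_smul, row_rowAt_ne his, row_rowAt_ne hit, smul_zero, smul_zero,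
          add_zero]
      · rw [row_add, row_smul, row_smul, row_rowAt_self, row_rowAt_ne hst, smul_zero, add_zero]
      · rw [row_add, row_smul, row_smul, row_rowAt_ne hst.symm, row_rowAt_self, smul_zero, zero_add]
    · rintro ⟨hds, ⟨μ, hμ⟩, ⟨ν, hν⟩⟩
      refine ⟨(μ, ν), ?_⟩
      rw [prodGen_apply]
      have hrows : ∀ i, row (μ • rowAt s (lvec j c α β) + ν • rowAt t (lvec j c α (-β))) i =
          row d i := by
        intro i
        by_cases his : i = s
        · rw [his, row_add, row_smul, row_smul, row_rowAt_self, row_rowAt_ne hst, smul_zero,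
            add_zero, hμ]
        by_cases hit : i = t
        · rw [hit, row_add, row_smul, row_smul, row_rowAt_ne hst.symm, row_rowAt_self, smul_zero,
            zero_add, hν]
        rw [row_add, row_smul, row_smul, row_rowAt_ne his, row_rowAt_ne hit, smul_zero, smul_zero,
          add_zero, hds i his hit]
      funext ik
      obtain ⟨i, k⟩ := ik
      exact congrFun (hrows i) k

/-! #### Toric triples (rev 2.5): kernel pairs, perpendicular partners, one coordinate vector -/

/-- The four components of `T3` written out. -/
theorem T3_explicit (u v w : Fin 4 → K) :
    T3 u v w 0 = u 1 * (v 2 * w 3 + v 3 * w 2) + u 2 * (v 1 * w 3 + v 3 * w 1) +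
      u 3 * (v 1 * w 2 + v 2 * w 1) ∧
    T3 u v w 1 = u 0 * (v 2 * w 3 + v 3 * w 2) + u 2 * (v 0 * w 3 + v 3 * w 0) +
      u 3 * (v 0 * w 2 + v 2 * w 0) ∧
    T3 u v w 2 = u 0 * (v 1 * w 3 + v 3 * w 1) + u 1 * (v 0 * w 3 + v 3 * w 0) +
      u 3 * (v 0 * w 1 + v 1 * w 0) ∧
    T3 u v w 3 = u 0 * (v 1 * w 2 + v 2 * w 1) + u 1 * (v 0 * w 2 + v 2 * w 0) +
      u 2 * (v 0 * w 1 + v 1 * w 0) := by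
  refine ⟨?_, ?_, ?_, ?_⟩ <;> simp [T3, Fin.succAbove]

/-- Auxiliary: `pairPerm_comm` (val-idea-18, SING-SIX classification). [folklore] -/
theorem pairPerm_comm (v w : Fin 4 → K) (p q : Fin 4) : pairPerm v w p q = pairPerm w v p q := by
  unfold pairPerm; ring

/-- Perm-orthogonality from the six values. -/
theorem permOrth_of_six {v w : Fin 4 → K} (m01 : pairPerm v w 0 1 = 0)
    (m02 : pairPerm v w 0 2 = 0) (m03 : pairPerm v w 0 3 = 0) (m12 : pairPerm v w 1 2 = 0)
    (m13 : pairPerm v w 1 3 = 0) (m23 : pairPerm v w 2 3 = 0) : PermOrth v w := by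
  have hsymm : ∀ p q, pairPerm v w p q = pairPerm v w q p := fun p q => by unfold pairPerm; ring
  intro p q hpq
  rcases fin4_cases p with rfl | rfl | rfl | rfl <;>
    rcases fin4_cases q with rfl | rfl | rfl | rfl <;>
    first | exact absurd rfl hpq | assumption | (rw [hsymm]; assumption)

/-- KERNEL PAIR at `(0, 1)`: if `P(v, w)` kills `x = (1, 0, *, *)` and `y = (0, 1, *, *)` and
`m_{01}(v, w) = 0` (the `(2, 3)` entry of `P(v, w)`), then `v ⊥ w` — the five other entries are read
off `(P(v,w) x)_{1,2,3} = 0`, `(P(v,w) y)_{2,3} = 0`.  (So the symmetric zero-diagonal matrices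
killing a `2`-plane form a line: the `2`-dimensional-kernel sequel of the rank drop.) -/
theorem smallKer01 (v w x y : Fin 4 → K) (hx0 : x 0 = 1) (hx1 : x 1 = 0) (hy0 : y 0 = 0)
    (hy1 : y 1 = 1) (hx : ∀ l, T3 x v w l = 0) (hy : ∀ l, T3 y v w l = 0)
    (h01 : pairPerm v w 0 1 = 0) : PermOrth v w := by
  have m01 : v 0 * w 1 + v 1 * w 0 = 0 := h01
  have e2 := hx 2
  rw [(T3_explicit x v w).2.2.1, hx0, hx1] at e2
  have e3 := hx 3
  rw [(T3_explicit x v w).2.2.2, hx0, hx1] at e3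
  have e1 := hx 1
  rw [(T3_explicit x v w).2.1, hx0] at e1
  have f2 := hy 2
  rw [(T3_explicit y v w).2.2.1, hy0, hy1] at f2
  have f3 := hy 3
  rw [(T3_explicit y v w).2.2.2, hy0, hy1] at f3
  have m13 : v 1 * w 3 + v 3 * w 1 = 0 := by linear_combination e2 - x 3 * m01
  have m12 : v 1 * w 2 + v 2 * w 1 = 0 := by linear_combination e3 - x 2 * m01
  have m03 : v 0 * w 3 + v 3 * w 0 = 0 := by linear_combination f2 - y 3 * m01
  have m02 : v 0 * w 2 + v 2 * w 0 = 0 := by linear_combination f3 - y 2 * m01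
  have m23 : v 2 * w 3 + v 3 * w 2 = 0 := by linear_combination e1 - x 2 * m03 - x 3 * m02
  exact permOrth_of_six m01 m02 m03 m12 m13 m23

/-- KERNEL PAIR, general position `(p, q)` (transport of `smallKer01` by `T3_perm`). -/
theorem smallKer {p q : Fin 4} (hpq : p ≠ q) (v w x y : Fin 4 → K) (hxp : x p = 1)
    (hxq : x q = 0) (hyp : y p = 0) (hyq : y q = 1) (hx : ∀ l, T3 x v w l = 0)
    (hy : ∀ l, T3 y v w l = 0) (hm : pairPerm v w p q = 0) : PermOrth v w := by
  obtain ⟨γ, hγ0, hγ1⟩ := exists_perm_zero_one hpq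
  have h := smallKer01 (v ∘ γ) (w ∘ γ) (x ∘ γ) (y ∘ γ)
    (by simp [hγ0, hxp]) (by simp [hγ1, hxq]) (by simp [hγ0, hyp]) (by simp [hγ1, hyq])
    (fun l => by rw [T3_perm]; exact hx _) (fun l => by rw [T3_perm]; exact hy _)
    (by simp only [pairPerm, Function.comp_apply, hγ0, hγ1]; exact hm)
  intro a b hab
  have := h (γ.symm a) (γ.symm b) (by simpa using hab)
  simpa [pairPerm] using this

/-- `T3 (u, v, e_l) = 0` makes all `2 × 2` permanents of `(u ; v)` off the column `l` vanish. -/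
theorem pairPerm_of_T3_single {l : Fin 4} {u v : Fin 4 → K}
    (h : ∀ l', T3 u v (Pi.single l 1) l' = 0) {p q : Fin 4} (hpq : p ≠ q) (hpl : p ≠ l)
    (hql : q ≠ l) : pairPerm u v p q = 0 := by
  obtain ⟨γ, hγ0, hγ1⟩ := exists_perm_zero_one hpq
  have hsingle : (Pi.single l (1 : K)) ∘ γ = Pi.single (γ.symm l) 1 := by
    funext k
    simp only [Function.comp_apply, Pi.single_apply, Equiv.eq_symm_apply]
  have hT : ∀ l'', T3 (u ∘ γ) (v ∘ γ) (Pi.single (γ.symm l) (1 : K)) l'' = 0 := fun l'' => by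
    rw [← hsingle, T3_perm]; exact h _
  have hne0 : γ.symm l ≠ 0 := by
    intro h0; apply hpl; rw [← hγ0, ← h0, Equiv.apply_symm_apply]
  have hne1 : γ.symm l ≠ 1 := by
    intro h1; apply hql; rw [← hγ1, ← h1, Equiv.apply_symm_apply]
  have key : u (γ 0) * v (γ 1) + u (γ 1) * v (γ 0) = 0 := by
    rcases fin4_cases (γ.symm l) with h0 | h1 | h2 | h3
    · exact absurd h0 hne0
    · exact absurd h1 hne1
    · have e := hT 3
      rw [h2, (T3_explicit _ _ _).2.2.2] at e
      simp at e
      linear_combination e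
    · have e := hT 2
      rw [h3, (T3_explicit _ _ _).2.2.1] at e
      simp at e
      linear_combination e
  simpa [pairPerm, hγ0, hγ1] using key

end Summit.ValiantsHypothesis.ValiantsHypothesis.Theorems.SymPencilSingSixClassification

end
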